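import Summits.AnomalousDissipation.AnomalousDissipation.Theorems.BaireTransferRobustLoudUpgradeLine

/-!
# Line `malkin-cone-group-orbits` (lead c15), registered stub `stub_fort`: Fort's theorem
# (crux `BaireTransfer.RobustLoudUpgrade`, stmt-AnomalousDissipation-1144)

Pure topology (Mathlib vocabulary only).  **Fort's theorem** (M. K. Fort, *Points of continuity of
semicontinuous functions*, Publ. Math. Debrecen 2 (1951) 100–102, Thm 2; Kuratowski, *Topology* I §18, §43):
an upper-hemicontinuous set-valued map `Φ : X → Set Y` into a regular second-countable space `Y` is lower
hemicontinuous at every point of `X` outside a meagre set.  (No Baire hypothesis on `X` is needed for the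
meagreness statement; in a Baire space the points of lower hemicontinuity are then dense — that corollary is
drawn in the lead's assembly, not here.)

Proof.  Let `𝔅` be a countable basis of `Y`.  For `V ∈ 𝔅` let `B V := {x | (Φ x ∩ closure V).Nonempty}`; it is
the complement of the upper inverse image `{x | Φ x ⊆ (closure V)ᶜ}` of an open set, hence CLOSED by upper
hemicontinuity, so its frontier `B V \ interior (B V)` is closed with empty interior, i.e. nowhere dense.  If `Φ`
is not lower hemicontinuous at `x`, there are an open `U` and `y ∈ Φ x ∩ U` such that `(Φ x' ∩ U).Nonempty`
fails for `x'` arbitrarily close to `x`; regularity gives `V ∈ 𝔅` with `y ∈ V` and `closure V ⊆ U`, whence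
`x ∈ B V` but `x ∉ interior (B V)` (otherwise `Φ x'` would meet `closure V ⊆ U` for all `x'` near `x`).  So the
set of points of non-lower-hemicontinuity lies in `⋃_{V ∈ 𝔅} frontier (B V)`, a countable union of nowhere
dense sets.
-/

-- `Summit.<Summit>.<Problem>` is the tree's mandated summit-side namespace (CONVENTIONS §2); for this
-- single-conjunct summit the two coincide, so the duplicate is deliberate.
set_option linter.dupNamespace false

open scoped Topology
open Filter Set TopologicalSpace

namespace Summit.AnomalousDissipation.AnomalousDissipation.Theorems.RobustLoudUpgrade.Category

/-- The *lower inverse image* `{x | (Φ x ∩ t).Nonempty}` of a CLOSED set `t` under an upper-hemicontinuous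
correspondence `Φ` is closed (it is the complement of the open upper inverse image `{x | Φ x ⊆ tᶜ}`). [folklore] -/
theorem isClosed_setOf_inter_nonempty {X Y : Type*} [TopologicalSpace X] [TopologicalSpace Y]
    {Φ : X → Set Y} (hΦ : UpperHemicontinuous Φ) {t : Set Y} (ht : IsClosed t) :
    IsClosed {x | (Φ x ∩ t).Nonempty} := by
  have h : IsClosed (Φ ⁻¹' Iic tᶜ)ᶜ :=
    upperHemicontinuous_iff_isClosed_compl_preimage_Iic_compl.mp hΦ t ht
  convert h using 1
  ext x
  simp only [mem_setOf_eq, mem_compl_iff, mem_preimage, mem_Iic,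
    subset_compl_iff_disjoint_right, not_disjoint_iff_nonempty_inter]

/-- **Fort's theorem** (registered sub-goal `stub_fort`, c15).  An upper-hemicontinuous correspondence with
values in a regular second-countable space is lower hemicontinuous at every point outside a meagre set
(Kuratowski, *Topology* I §43). [cite: Fort1951, Thm 2] -/
theorem stub_fort : ∀ {X Y : Type} [TopologicalSpace X] [TopologicalSpace Y] [SecondCountableTopology Y] [RegularSpace Y]
    (Φ : X → Set Y), UpperHemicontinuous Φ → IsMeagre {x | ¬ LowerHemicontinuousAt Φ x} := by
  intro X Y _ _ _ _ Φ hΦ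
  -- the closed sets `B V`, `V` in the countable basis, and their nowhere-dense frontiers
  have hB : ∀ V : Set Y, IsClosed {x | (Φ x ∩ closure V).Nonempty} := fun V =>
    isClosed_setOf_inter_nonempty hΦ isClosed_closure
  have hfr : ∀ V : Set Y, IsMeagre (frontier {x | (Φ x ∩ closure V).Nonempty}) := fun V =>
    (isClosed_frontier.isNowhereDense_iff.mpr (interior_frontier (hB V))).isMeagre
  have hM : IsMeagre (⋃ V ∈ countableBasis Y, frontier {x | (Φ x ∩ closure V).Nonempty}) :=
    isMeagre_biUnion (countable_countableBasis Y) fun V _ => hfr V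
  refine hM.mono ?_
  intro x hx
  -- unpack the failure of lower hemicontinuity at `x`
  have hx' : ∃ U : Set Y, IsOpen U ∧ (Φ x ∩ U).Nonempty ∧ ¬ ∀ᶠ x' in 𝓝 x, (Φ x' ∩ U).Nonempty := by
    by_contra h
    refine hx (lowerHemicontinuousAt_iff.mpr fun U hU hne => ?_)
    by_contra h'
    exact h ⟨U, hU, hne, h'⟩
  obtain ⟨U, hU, ⟨y, hyΦ, hyU⟩, hnot⟩ := hx'
  -- a basic open `V ∋ y` with `closure V ⊆ U` (regularity)
  obtain ⟨V, hVB, hyV, hVU⟩ := (isBasis_countableBasis Y).exists_closure_subset (hU.mem_nhds hyU)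
  refine mem_iUnion₂.mpr ⟨V, hVB, ?_⟩
  rw [(hB V).frontier_eq]
  refine ⟨⟨y, hyΦ, subset_closure hyV⟩, fun hxint => hnot ?_⟩
  have hev : ∀ᶠ x' in 𝓝 x, x' ∈ {x | (Φ x ∩ closure V).Nonempty} := mem_interior_iff_mem_nhds.mp hxint
  exact hev.mono fun x' hx' => Set.Nonempty.mono (inter_subset_inter_right (Φ x') hVU) hx'

end Summit.AnomalousDissipation.AnomalousDissipation.Theorems.RobustLoudUpgrade.Category
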